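import Summits.CriticalPhenomena.Ising3DConformalLimit.Theorems.ReflectionTwinTwinThresholdPlaneSummableRenewalBounds
import HarnessLib

/-!
# Seam renewal for the (111) reflection twin, III: the half-box states are the (W1) states; the renewal bound

Crux `TwinThreshold` (stmt-CriticalPhenomena-16906), line `seam_renewal`, stub (W2) `stub_planeSummable_of_surfaceSummable`,
continued from `…PlaneSummableRenewalBounds.lean`.

* The twin model restricted to the lower half-box `Bm` IS the n.n. model on `H⁻ ∩ Λ_L` at `β_c` (`avg_Bm_eq`), and restricted to
  the upper half-box `Bp` it is that model after `z ↦ -z` (`avg_Bp_eq`, `PairIsing.gibbsAvg_comp_equiv` along `eBp`); each such box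
  state is one term of the sup `halfLat`, so the layer-`(∓1)` row sums of the restricted states are bounded by the constant of
  hypothesis (W1) (`sum_avg_Bm_le`, `sum_avg_Bp_le`).
* `Ssum_le_three` — the finite linear renewal system in the box: with `A = max_{plane} S`, `B₁ = max_{layers ±1} S` (`fmax`),
  `renewal_site` + `degree_plane` give `S(a) ≤ 1 + 6β_cJ (S(a) + B₁)` on the plane, `renewal_half` + `degree_lower/upper` + (W1)
  give `S(v) ≤ 3β_cJ C₁ (A + B₁)` on layers `±1`; for `6β_cJ ≤ 1/2` and `3β_cJ C₁ ≤ 1/4` this forces `A ≤ 3`, uniformly in `L`.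

Sources: Aizenman–Duminil-Copin (2021) Lemma 5.7; Simon / Lieb (1980); Friedli–Velenik (2017) §3.6–3.8. Proofs only.
-/

noncomputable section

namespace Summit.CriticalPhenomena.Ising3DConformalLimit.Cruxes.TwinThreshold.SeamRenewal.PlaneSummable

open scoped BigOperators Classical
open Filter Topology Finset
open Literature.Probability.LatticeModels
open Summit.CriticalPhenomena.Ising3DConformalLimit.Cruxes.ExistsScaleCovariantLimit.DecimationHomotopyRate

/-! ## The restricted half-box states are the half-crystal states of `(W1)` -/

/-- `|halfObs| ≤ 1`. [folklore] -/
theorem abs_halfObs_le_one (L : ℕ) {k : ℕ} (z : Fin k → Site 3) (s : SpinConfig ↥(lowerBox L)) :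
    |halfObs L z s| ≤ 1 := by
  unfold halfObs
  rw [Finset.abs_prod]
  refine Finset.prod_le_one (fun i _ => abs_nonneg _) fun i _ => ?_
  split_ifs
  · rw [abs_spinAt]
  · rw [abs_zero]; exact zero_le_one

/-- The half-crystal box averages are bounded by one, so the sup over boxes is a real sup. [folklore] -/
theorem halfLat_bdd {k : ℕ} (z : Fin k → Site 3) :
    BddAbove (Set.range fun L : ℕ => PairIsing.gibbsAvg (halfCpl L) (halfObs L z)) :=
  ⟨1, by
    rintro _ ⟨L, rfl⟩
    exact (le_abs_self _).trans (TwoCouplingGKS.abs_gibbsAvg_le_one _ (abs_halfObs_le_one L z))⟩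

/-- `σ_x(s ∘ f) = σ_{f x}(s)`. [folklore] -/
theorem spinAt_comp {α β : Type*} (f : α → β) (x : α) (s : SpinConfig β) : spinAt x (s ∘ f) = spinAt (f x) s := rfl

/-- The twin model restricted to the lower half-box IS the n.n. model on `H⁻ ∩ Λ_L` at `β_c`:
`⟨σ_vσ_u⟩_{c|_{B⁻}} = ⟨σ_vσ_u⟩_{H⁻∩Λ_L}`. [folklore] -/
theorem avg_Bm_eq (J : ℝ) (L : ℕ) (v u : ↥(Bm L)) :
    PairIsing.avg (fun a' b' : ↥(Bm L) => twinCpl J L a' b') (spinPair v u) =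
      PairIsing.gibbsAvg (halfCpl L) (halfObs L ![v.1.1, u.1.1]) := by
  rw [← PairIsing.gibbsAvg_comp_equiv (eBm L) (halfCpl L) (halfObs L ![v.1.1, u.1.1])]
  show PairIsing.gibbsAvg _ _ = PairIsing.gibbsAvg _ _
  congr 1
  · funext a b
    show twinW J a.1.1 b.1.1 = halfW a.1.1 b.1.1
    have ha := mem_Bm.1 a.2
    have hb := mem_Bm.1 b.2
    exact twinW_eq_halfW (by omega) (by omega)
  · funext s
    have hv : v.1.1 ∈ lowerBox L := ((eBm L) v).2
    have hu : u.1.1 ∈ lowerBox L := ((eBm L) u).2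
    simp only [halfObs, Fin.prod_univ_two, Matrix.cons_val_zero, Matrix.cons_val_one, spinPair]
    rw [dif_pos hv, dif_pos hu]
    rfl

/-- The twin model restricted to the upper half-box is, after `z ↦ -z`, the n.n. model on `H⁻ ∩ Λ_L`:
`⟨σ_vσ_u⟩_{c|_{B⁺}} = ⟨σ_{-v}σ_{-u}⟩_{H⁻∩Λ_L}`. [folklore] -/
theorem avg_Bp_eq (J : ℝ) (L : ℕ) (v u : ↥(Bp L)) :
    PairIsing.avg (fun a' b' : ↥(Bp L) => twinCpl J L a' b') (spinPair v u) =
      PairIsing.gibbsAvg (halfCpl L) (halfObs L ![-v.1.1, -u.1.1]) := by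
  rw [← PairIsing.gibbsAvg_comp_equiv (eBp L) (halfCpl L) (halfObs L ![-v.1.1, -u.1.1])]
  show PairIsing.gibbsAvg _ _ = PairIsing.gibbsAvg _ _
  congr 1
  · funext a b
    show twinW J a.1.1 b.1.1 = halfW (-a.1.1) (-b.1.1)
    have ha := mem_Bp.1 a.2
    have hb := mem_Bp.1 b.2
    rw [halfW_neg]
    exact twinW_eq_halfW (by omega) (by omega)
  · funext s
    have hv : -v.1.1 ∈ lowerBox L := ((eBp L) v).2
    have hu : -u.1.1 ∈ lowerBox L := ((eBp L) u).2
    have h1 : (eBp L).symm ⟨-v.1.1, hv⟩ = v := Subtype.ext (Subtype.ext (neg_neg _))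
    have h2 : (eBp L).symm ⟨-u.1.1, hu⟩ = u := Subtype.ext (Subtype.ext (neg_neg _))
    simp only [halfObs, Fin.prod_univ_two, Matrix.cons_val_zero, Matrix.cons_val_one, spinPair]
    rw [dif_pos hv, dif_pos hu, spinAt_comp, spinAt_comp, h1, h2]

/-- Layer `-1` row sums of the restricted lower state are bounded by the surface susceptibility constant of
`(W1)` (each box state is one term of the sup `halfLat`). [folklore] -/
theorem sum_avg_Bm_le (J : ℝ) (L : ℕ) {C₁ : ℝ}
    (hW : ∀ v : Site 3, hh v = -1 → ∀ F : Finset (Site 3), (∀ u ∈ F, hh u = -1) →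
      ∑ u ∈ F, halfLat 2 ![v, u] ≤ C₁)
    (v : ↥(Bm L)) (hv : hh v.1.1 = -1) :
    ∑ u : ↥(Bm L), (if hh u.1.1 = -1 then
      PairIsing.avg (fun a' b' : ↥(Bm L) => twinCpl J L a' b') (spinPair v u) else 0) ≤ C₁ := by
  have hle : ∀ u : ↥(Bm L), PairIsing.avg (fun a' b' : ↥(Bm L) => twinCpl J L a' b') (spinPair v u) ≤
      halfLat 2 ![v.1.1, u.1.1] := fun u => by
    rw [avg_Bm_eq]
    exact le_ciSup (halfLat_bdd ![v.1.1, u.1.1]) L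
  set F : Finset (Site 3) := ((Bm L).filter (fun u => hh u.1 = -1)).map (Function.Embedding.subtype _) with hF
  have hFmem : ∀ y ∈ F, hh y = -1 := by
    intro y hy
    rw [hF, Finset.mem_map] at hy
    obtain ⟨u, hu, rfl⟩ := hy
    exact (Finset.mem_filter.1 hu).2
  calc ∑ u : ↥(Bm L), (if hh u.1.1 = -1 then
          PairIsing.avg (fun a' b' : ↥(Bm L) => twinCpl J L a' b') (spinPair v u) else 0)
      ≤ ∑ u : ↥(Bm L), (if hh u.1.1 = -1 then halfLat 2 ![v.1.1, u.1.1] else 0) :=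
        Finset.sum_le_sum fun u _ => by
          split_ifs
          · exact hle u
          · exact le_rfl
    _ = ∑ u ∈ Bm L, (if hh u.1 = -1 then halfLat 2 ![v.1.1, u.1] else 0) :=
        Finset.sum_coe_sort (Bm L) (fun u => if hh u.1 = -1 then halfLat 2 ![v.1.1, u.1] else 0)
    _ = ∑ u ∈ (Bm L).filter (fun u => hh u.1 = -1), halfLat 2 ![v.1.1, u.1] := (Finset.sum_filter _ _).symm
    _ = ∑ y ∈ F, halfLat 2 ![v.1.1, y] := by rw [hF, Finset.sum_map]; rfl
    _ ≤ C₁ := hW v.1.1 hv F hFmem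

/-- Layer `1` row sums of the restricted upper state are bounded by the surface susceptibility constant of
`(W1)`, transported by `z ↦ -z`. [folklore] -/
theorem sum_avg_Bp_le (J : ℝ) (L : ℕ) {C₁ : ℝ}
    (hW : ∀ v : Site 3, hh v = -1 → ∀ F : Finset (Site 3), (∀ u ∈ F, hh u = -1) →
      ∑ u ∈ F, halfLat 2 ![v, u] ≤ C₁)
    (v : ↥(Bp L)) (hv : hh v.1.1 = 1) :
    ∑ u : ↥(Bp L), (if hh u.1.1 = 1 then
      PairIsing.avg (fun a' b' : ↥(Bp L) => twinCpl J L a' b') (spinPair v u) else 0) ≤ C₁ := by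
  have hle : ∀ u : ↥(Bp L), PairIsing.avg (fun a' b' : ↥(Bp L) => twinCpl J L a' b') (spinPair v u) ≤
      halfLat 2 ![-v.1.1, -u.1.1] := fun u => by
    rw [avg_Bp_eq]
    exact le_ciSup (halfLat_bdd ![-v.1.1, -u.1.1]) L
  set F : Finset (Site 3) :=
    (((Bp L).filter (fun u => hh u.1 = 1)).map (Function.Embedding.subtype _)).image (fun y => -y) with hF
  have hFmem : ∀ y ∈ F, hh y = -1 := by
    intro y hy
    rw [hF, Finset.mem_image] at hy
    obtain ⟨x, hx, rfl⟩ := hy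
    rw [Finset.mem_map] at hx
    obtain ⟨u, hu, rfl⟩ := hx
    rw [hh_neg]
    have := (Finset.mem_filter.1 hu).2
    simp only [Function.Embedding.coe_subtype] at this ⊢
    omega
  calc ∑ u : ↥(Bp L), (if hh u.1.1 = 1 then
          PairIsing.avg (fun a' b' : ↥(Bp L) => twinCpl J L a' b') (spinPair v u) else 0)
      ≤ ∑ u : ↥(Bp L), (if hh u.1.1 = 1 then halfLat 2 ![-v.1.1, -u.1.1] else 0) :=
        Finset.sum_le_sum fun u _ => by
          split_ifs
          · exact hle u
          · exact le_rfl
    _ = ∑ u ∈ Bp L, (if hh u.1 = 1 then halfLat 2 ![-v.1.1, -u.1] else 0) :=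
        Finset.sum_coe_sort (Bp L) (fun u => if hh u.1 = 1 then halfLat 2 ![-v.1.1, -u.1] else 0)
    _ = ∑ u ∈ (Bp L).filter (fun u => hh u.1 = 1), halfLat 2 ![-v.1.1, -u.1] := (Finset.sum_filter _ _).symm
    _ = ∑ x ∈ ((Bp L).filter (fun u => hh u.1 = 1)).map (Function.Embedding.subtype _),
          halfLat 2 ![-v.1.1, -x] := by rw [Finset.sum_map]; rfl
    _ = ∑ y ∈ F, halfLat 2 ![-v.1.1, y] := by
        rw [hF, Finset.sum_image (fun x _ y _ h => neg_injective h)]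
    _ ≤ C₁ := hW (-v.1.1) (by rw [hh_neg, hv]) F hFmem

/-! ## The renewal bound on plane sums, uniformly in the box -/

/-- **The renewal bound.** If `6 β_c J ≤ 1/2` and `3 β_c J C₁ ≤ 1/4`, where `C₁ ≥ 0` bounds the layer-`(-1)` row sums of
the half-crystal pair function (hypothesis `(W1)`), then every plane sum of the twin box state is `≤ 3`, uniformly in the
box: with `A = max_{a ∈ plane} S(a)`, `B₁ = max_{v ∈ layers ±1} S(v)`, the two renewal inequalities give `A ≤ 2 + B₁` and
`B₁ ≤ (A + B₁)/4`. [cite: AizenmanDuminilCopinAnnals2021, Lemma 5.7] -/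
theorem Ssum_le_three {J : ℝ} (hJ : 0 ≤ J) (L : ℕ) {C₁ : ℝ} (hC₁ : 0 ≤ C₁)
    (ht6 : 6 * (criticalBeta 3 * J) ≤ 1 / 2) (ht3 : 3 * (criticalBeta 3 * J) * C₁ ≤ 1 / 4)
    (hW : ∀ v : Site 3, hh v = -1 → ∀ F : Finset (Site 3), (∀ u ∈ F, hh u = -1) →
      ∑ u ∈ F, halfLat 2 ![v, u] ≤ C₁)
    (a : ↥(box 3 L)) (ha : hh a.1 = 0) : Ssum J L a ≤ 3 := by
  obtain ⟨A, hAdef⟩ : ∃ A : ℝ, A = fmax (Pl L) (Ssum J L) := ⟨_, rfl⟩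
  obtain ⟨B₁, hBdef⟩ : ∃ B : ℝ, B = fmax (Ql L) (Ssum J L) := ⟨_, rfl⟩
  have hA0 : 0 ≤ A := hAdef ▸ fmax_nonneg fun x _ => Ssum_nonneg hJ L x
  have hB0 : 0 ≤ B₁ := hBdef ▸ fmax_nonneg fun x _ => Ssum_nonneg hJ L x
  have hleA : ∀ w ∈ Pl L, Ssum J L w ≤ A := fun w hw => by rw [hAdef]; exact le_fmax _ hw
  have hleB : ∀ w ∈ Ql L, Ssum J L w ≤ B₁ := fun w hw => by rw [hBdef]; exact le_fmax _ hw
  have ht : 0 ≤ criticalBeta 3 * J := mul_nonneg (criticalBeta_nonneg 3) hJ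
  have hcc : ∀ u v : Site 3, 0 ≤ twinW J u v + twinW J v u :=
    fun u v => add_nonneg (twinW_nonneg hJ _ _) (twinW_nonneg hJ _ _)
  -- (i) plane base points
  have hplane : ∀ x ∈ Pl L, Ssum J L x ≤ 2 + B₁ := by
    intro x hx
    have hx0 : hh x.1 = 0 := mem_Pl.1 hx
    have h1 := renewal_site hJ L x
    have h2 : ∑ v : ↥(box 3 L), (twinW J x.1 v.1 + twinW J v.1 x.1) * (Ssum J L x + Ssum J L v) ≤
        6 * (criticalBeta 3 * J) * (Ssum J L x + B₁) := by
      calc ∑ v : ↥(box 3 L), (twinW J x.1 v.1 + twinW J v.1 x.1) * (Ssum J L x + Ssum J L v)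
          ≤ ∑ v : ↥(box 3 L), (twinW J x.1 v.1 + twinW J v.1 x.1) * (Ssum J L x + B₁) := by
            refine Finset.sum_le_sum fun v _ => ?_
            by_cases h0 : twinW J x.1 v.1 + twinW J v.1 x.1 = 0
            · rw [h0, zero_mul, zero_mul]
            · exact mul_le_mul_of_nonneg_left
                (add_le_add le_rfl (hleB _ (mem_Ql.2 (layer_of_cpl_plane hx0 h0)))) (hcc _ _)
        _ = (∑ v : ↥(box 3 L), (twinW J x.1 v.1 + twinW J v.1 x.1)) * (Ssum J L x + B₁) := by
            rw [Finset.sum_mul]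
        _ ≤ 6 * (criticalBeta 3 * J) * (Ssum J L x + B₁) :=
            mul_le_mul_of_nonneg_right (degree_plane hJ x hx0) (add_nonneg (Ssum_nonneg hJ L x) hB0)
    have h3 : 6 * (criticalBeta 3 * J) * (Ssum J L x + B₁) ≤ 1 / 2 * (Ssum J L x + B₁) :=
      mul_le_mul_of_nonneg_right ht6 (add_nonneg (Ssum_nonneg hJ L x) hB0)
    linarith
  -- (ii) base points in layers ±1
  have hlayer : ∀ v ∈ Ql L, Ssum J L v ≤ 3 * (criticalBeta 3 * J) * C₁ * (B₁ + A) := by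
    intro v hv
    rcases mem_Ql.1 hv with hv1 | hv1
    · have hvB : v ∈ Bm L := mem_Bm.2 (by omega)
      have hPB : ∀ z ∈ Pl L, z ∉ Bm L := fun z hz h => by
        have := mem_Pl.1 hz; have := mem_Bm.1 h; omega
      have hcomp : ∀ w ∈ (Bm L)ᶜ, 0 ≤ hh w.1 := fun w hw => by
        have h := Finset.mem_compl.1 hw; rw [mem_Bm] at h; omega
      have hR : ∀ u : ↥(Bm L), 0 ≤ PairIsing.avg (fun a' b' : ↥(Bm L) => twinCpl J L a' b') (spinPair ⟨v, hvB⟩ u) :=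
        fun u => avgB_nonneg hJ L (Bm L) ⟨v, hvB⟩ u
      refine (renewal_half hJ L (Bm L) hPB hvB).trans ?_
      calc ∑ u : ↥(Bm L), ∑ w ∈ (Bm L)ᶜ, (twinW J u.1.1 w.1 + twinW J w.1 u.1.1) *
              PairIsing.avg (fun a' b' : ↥(Bm L) => twinCpl J L a' b') (spinPair ⟨v, hvB⟩ u) *
                (Ssum J L u + Ssum J L w)
          ≤ ∑ u : ↥(Bm L), ∑ w ∈ (Bm L)ᶜ, (twinW J u.1.1 w.1 + twinW J w.1 u.1.1) *
              PairIsing.avg (fun a' b' : ↥(Bm L) => twinCpl J L a' b') (spinPair ⟨v, hvB⟩ u) * (B₁ + A) := by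
            refine Finset.sum_le_sum fun u _ => Finset.sum_le_sum fun w hw => ?_
            by_cases h0 : twinW J u.1.1 w.1 + twinW J w.1 u.1.1 = 0
            · rw [h0, zero_mul, zero_mul, zero_mul]
            · obtain ⟨hu1, hw0⟩ := layer_of_cpl_lower (mem_Bm.1 u.2) (hcomp w hw) h0
              exact mul_le_mul_of_nonneg_left
                (add_le_add (hleB _ (mem_Ql.2 (Or.inl hu1))) (hleA _ (mem_Pl.2 hw0)))
                (mul_nonneg (hcc _ _) (hR u))
        _ = ∑ u : ↥(Bm L), (∑ w ∈ (Bm L)ᶜ, (twinW J u.1.1 w.1 + twinW J w.1 u.1.1)) *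
              (PairIsing.avg (fun a' b' : ↥(Bm L) => twinCpl J L a' b') (spinPair ⟨v, hvB⟩ u) * (B₁ + A)) := by
            refine Finset.sum_congr rfl fun u _ => ?_
            rw [Finset.sum_mul]
            exact Finset.sum_congr rfl fun w _ => by ring
        _ ≤ ∑ u : ↥(Bm L), (if hh u.1.1 = -1 then 3 * (criticalBeta 3 * J) else 0) *
              (PairIsing.avg (fun a' b' : ↥(Bm L) => twinCpl J L a' b') (spinPair ⟨v, hvB⟩ u) * (B₁ + A)) :=
            Finset.sum_le_sum fun u _ => mul_le_mul_of_nonneg_right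
              (degree_lower hJ u.1 (mem_Bm.1 u.2) _ hcomp) (mul_nonneg (hR u) (add_nonneg hB0 hA0))
        _ = 3 * (criticalBeta 3 * J) * (B₁ + A) * ∑ u : ↥(Bm L), (if hh u.1.1 = -1 then
              PairIsing.avg (fun a' b' : ↥(Bm L) => twinCpl J L a' b') (spinPair ⟨v, hvB⟩ u) else 0) := by
            rw [Finset.mul_sum]
            exact Finset.sum_congr rfl fun u _ => by split_ifs <;> ring
        _ ≤ 3 * (criticalBeta 3 * J) * (B₁ + A) * C₁ :=
            mul_le_mul_of_nonneg_left (sum_avg_Bm_le J L hW ⟨v, hvB⟩ hv1)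
              (mul_nonneg (mul_nonneg (by norm_num) ht) (add_nonneg hB0 hA0))
        _ = 3 * (criticalBeta 3 * J) * C₁ * (B₁ + A) := by ring
    · have hvB : v ∈ Bp L := mem_Bp.2 (by omega)
      have hPB : ∀ z ∈ Pl L, z ∉ Bp L := fun z hz h => by
        have := mem_Pl.1 hz; have := mem_Bp.1 h; omega
      have hcomp : ∀ w ∈ (Bp L)ᶜ, hh w.1 ≤ 0 := fun w hw => by
        have h := Finset.mem_compl.1 hw; rw [mem_Bp] at h; omega
      have hR : ∀ u : ↥(Bp L), 0 ≤ PairIsing.avg (fun a' b' : ↥(Bp L) => twinCpl J L a' b') (spinPair ⟨v, hvB⟩ u) :=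
        fun u => avgB_nonneg hJ L (Bp L) ⟨v, hvB⟩ u
      refine (renewal_half hJ L (Bp L) hPB hvB).trans ?_
      calc ∑ u : ↥(Bp L), ∑ w ∈ (Bp L)ᶜ, (twinW J u.1.1 w.1 + twinW J w.1 u.1.1) *
              PairIsing.avg (fun a' b' : ↥(Bp L) => twinCpl J L a' b') (spinPair ⟨v, hvB⟩ u) *
                (Ssum J L u + Ssum J L w)
          ≤ ∑ u : ↥(Bp L), ∑ w ∈ (Bp L)ᶜ, (twinW J u.1.1 w.1 + twinW J w.1 u.1.1) *
              PairIsing.avg (fun a' b' : ↥(Bp L) => twinCpl J L a' b') (spinPair ⟨v, hvB⟩ u) * (B₁ + A) := by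
            refine Finset.sum_le_sum fun u _ => Finset.sum_le_sum fun w hw => ?_
            by_cases h0 : twinW J u.1.1 w.1 + twinW J w.1 u.1.1 = 0
            · rw [h0, zero_mul, zero_mul, zero_mul]
            · obtain ⟨hu1, hw0⟩ := layer_of_cpl_upper (mem_Bp.1 u.2) (hcomp w hw) h0
              exact mul_le_mul_of_nonneg_left
                (add_le_add (hleB _ (mem_Ql.2 (Or.inr hu1))) (hleA _ (mem_Pl.2 hw0)))
                (mul_nonneg (hcc _ _) (hR u))
        _ = ∑ u : ↥(Bp L), (∑ w ∈ (Bp L)ᶜ, (twinW J u.1.1 w.1 + twinW J w.1 u.1.1)) *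
              (PairIsing.avg (fun a' b' : ↥(Bp L) => twinCpl J L a' b') (spinPair ⟨v, hvB⟩ u) * (B₁ + A)) := by
            refine Finset.sum_congr rfl fun u _ => ?_
            rw [Finset.sum_mul]
            exact Finset.sum_congr rfl fun w _ => by ring
        _ ≤ ∑ u : ↥(Bp L), (if hh u.1.1 = 1 then 3 * (criticalBeta 3 * J) else 0) *
              (PairIsing.avg (fun a' b' : ↥(Bp L) => twinCpl J L a' b') (spinPair ⟨v, hvB⟩ u) * (B₁ + A)) :=
            Finset.sum_le_sum fun u _ => mul_le_mul_of_nonneg_right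
              (degree_upper hJ u.1 (mem_Bp.1 u.2) _ hcomp) (mul_nonneg (hR u) (add_nonneg hB0 hA0))
        _ = 3 * (criticalBeta 3 * J) * (B₁ + A) * ∑ u : ↥(Bp L), (if hh u.1.1 = 1 then
              PairIsing.avg (fun a' b' : ↥(Bp L) => twinCpl J L a' b') (spinPair ⟨v, hvB⟩ u) else 0) := by
            rw [Finset.mul_sum]
            exact Finset.sum_congr rfl fun u _ => by split_ifs <;> ring
        _ ≤ 3 * (criticalBeta 3 * J) * (B₁ + A) * C₁ :=
            mul_le_mul_of_nonneg_left (sum_avg_Bp_le J L hW ⟨v, hvB⟩ hv1)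
              (mul_nonneg (mul_nonneg (by norm_num) ht) (add_nonneg hB0 hA0))
        _ = 3 * (criticalBeta 3 * J) * C₁ * (B₁ + A) := by ring
  -- (iii) the linear system
  have hA : A ≤ 2 + B₁ := by
    have h := fmax_le (T := Pl L) (f := Ssum J L) (by linarith : (0 : ℝ) ≤ 2 + B₁) hplane
    rwa [← hAdef] at h
  have hB : B₁ ≤ 3 * (criticalBeta 3 * J) * C₁ * (B₁ + A) := by
    have h := fmax_le (T := Ql L) (f := Ssum J L)
      (mul_nonneg (mul_nonneg (mul_nonneg (by norm_num) ht) hC₁) (add_nonneg hB0 hA0)) hlayer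
    rwa [← hBdef] at h
  have hB' : B₁ ≤ 1 / 4 * (B₁ + A) := hB.trans (mul_le_mul_of_nonneg_right ht3 (add_nonneg hB0 hA0))
  have hAle : A ≤ 3 := by linarith
  exact (hleA a (mem_Pl.2 ha)).trans hAle

end Summit.CriticalPhenomena.Ising3DConformalLimit.Cruxes.TwinThreshold.SeamRenewal.PlaneSummable

namespace Summit.CriticalPhenomena.Ising3DConformalLimit.Cruxes.TwinThreshold.SeamRenewal

open Literature.Probability.LatticeModels

/-- **Registered sub-goal of part III** (anchor of this helper file on the crux item): the half-crystal box averages of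
hypothesis (W1) are bounded, so `halfLat` is a genuine sup (`PlaneSummable.halfLat_bdd`, by definitional unfolding). [folklore] -/
theorem stub_planeSummable_partIII_halfLatBdd : open Literature.Probability.LatticeModels in (∀ (k : ℕ) (z : Fin k → Site 3), BddAbove (Set.range fun L : ℕ => PairIsing.gibbsAvg (fun a b : ↥((box 3 L).filter (fun x : Site 3 => x 0 + x 1 + x 2 ≤ -1)) => if (∑ i, |a.1 i - b.1 i| = 1) then criticalBeta 3 / 2 else (0 : ℝ)) (fun s => ∏ i, if h : z i ∈ ((box 3 L).filter (fun x : Site 3 => x 0 + x 1 + x 2 ≤ -1)) then spinAt (⟨z i, h⟩ : ↥((box 3 L).filter (fun x : Site 3 => x 0 + x 1 + x 2 ≤ -1))) s else 0))) :=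
  fun _ z => PlaneSummable.halfLat_bdd z

end Summit.CriticalPhenomena.Ising3DConformalLimit.Cruxes.TwinThreshold.SeamRenewal

end
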